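import Literature.NumberTheory.ConnesConsani2021.SchwartzKernels
import Literature.NumberTheory.Automorphic.TateLocalFunctionalEquationReal
import Literature.NumberTheory.LFunctions.RiemannZetaChiTheta
import Mathlib.Analysis.Distribution.SchwartzSpace.Fourier
import HarnessLib

/-!
# Connes–Consani 2021, §1 Lemma 6: `𝔽_{e_ℝ}^w = I ∘ u_∞^g` — DISCHARGED

Topic `NumberTheory/ConnesConsani2021`; namespace `Literature.NumberTheory.ConnesConsani2021`.
Theorems only (no definition, no named fact, no instance, no `sorry`); companion of `SchwartzKernels`,
whose named fact `CC2021_lemma_6` (A. Connes, C. Consani, *Weil positivity and trace formula, the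
archimedean place*, Selecta Math. 27 (2021), §1 Lemma 6 of the arXiv numbering, p. 7; App. B p. 31)
it proves: for `ξ ∈ C_c^∞(ℝ₊*)` and real `s`,

  `𝔽_μ(archOp ξ)(−is) = u_∞(s) · 𝔽_μ(ξ)(−is)`,   `u_∞(s) = e^{2iθ(s)}`,

i.e. the integral operator `archOp = I ∘ w ∘ 𝔽_{e_ℝ} ∘ w⁻¹` (display (FwIPhi), PROVED in
`SchwartzKernels` as `archOp_eq_sqrtWeight_fourier_inv`) is `u_∞^g = 𝔽_μ⁻¹ u_∞ 𝔽_μ`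
(`𝔽_μ(f)(s) = mellin f (−is)`, eq. (11)).

**The printed route** (App. B p. 31: `u_∞` is the ratio of local factors of Tate's local functional
equation at the real place [tate]).  With `G := w⁻¹ξ` extended evenly (`invSqrtEvenExt ξ`, a smooth
even compactly supported function vanishing near `0`):
1. `𝔽_μ(archOp ξ)(−is) = (mellin 𝓕G)(½ + is)` (display (FwIPhi) and the substitutions `λ = v⁻¹`,
   `v^{1/2}`: Mathlib `mellin_comp_inv`, `mellin_cpow_smul`), and `𝔽_μ(ξ)(−is) = (mellin G)(½ − is)`;
2. Tate 1950, Thm. 2.4.1 at `k = ℝ` for the class `|·|^z`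
   (`TateArchimedean.mellin_fourier_mul_Gammaℝ_of_even`, file `TateLocalFunctionalEquationReal`):
   `(mellin 𝓕G)(z) Γ_ℝ(1−z) = Γ_ℝ(z) (mellin G)(1−z)` at `z = ½ + is`, its hypotheses (absolute
   convergence of `ζ(G, |·|^{1−z})`, `ζ(𝓕G, |·|^z)`) checked from `G ∈ C_c^∞(ℝ∖{0})` and `𝓕G ∈ 𝓢(ℝ)`;
3. `ρ(|·|^{½+is}) = Γ_ℝ(½+is)/Γ_ℝ(½−is) = π^{−is}Γ(¼+is/2)/Γ(¼−is/2) = e^{2iθ(s)} = u_∞(s)`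
   (`archUnitary_eq_Gammaℝ_div`, from the tree's `χ(½+it) e^{2iϑ(t)} = 1`,
   `χ(½+it) = π^{it}Γ(¼−it/2)/Γ(¼+it/2)` of `LFunctions.RiemannZetaChiTheta`; App. B eq. (84)).

* `contDiff_invSqrtEvenExt`, `invSqrtEvenExt_neg`, `hasCompactSupport_invSqrtEvenExt`,
  `integrable_invSqrtEvenExt`, `integrable_fourier_invSqrtEvenExt` — `w⁻¹ξ` extended evenly is in
  `C_c^∞(ℝ)`, even, with Schwartz (hence integrable) Fourier transform;
* `archUnitary_eq_Gammaℝ_div` — `u_∞(s) = Γ_ℝ(½+is)/Γ_ℝ(½−is)`;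
* **`CC2021_lemma_6_holds : CC2021_lemma_6`**.

## References

* A. Connes, C. Consani, *Weil positivity and trace formula, the archimedean place*, Selecta Math.
  (N.S.) 27 (2021), no. 4, Paper No. 77 (arXiv:2006.13771), §1 Lemma 6 (arXiv numbering), eq. (11),
  (14), display (FwIPhi) p. 7; App. B eq. (84) p. 31. [ConnesConsani2021]
* J. Tate, *Fourier analysis in number fields and Hecke's zeta-functions* (1950), in Cassels–Fröhlich,
  *Algebraic Number Theory* (1967), Ch. XV, §2.4 Thm. 2.4.1, §2.5 (`k` real). [TateThesis1967]
* E. C. Titchmarsh, *The Theory of the Riemann Zeta-Function*, 2nd ed. (1986), §4.17. [Titchmarsh1986]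
-/

noncomputable section

open MeasureTheory Set Real Complex Filter
open scoped FourierTransform Topology

namespace Literature.NumberTheory.ConnesConsani2021

open Literature.NumberTheory.LFunctions Literature.NumberTheory.Automorphic.TateArchimedean
open scoped ContDiff

/-- a.e. `x ≠ 0` for Lebesgue measure. [folklore] -/
private theorem ae_ne_zero' : ∀ᵐ x : ℝ, x ≠ 0 := by
  simp [ae_iff]

/-- `‖|x|^r‖ = |x|^{re r}` for `x ≠ 0`. [folklore] -/
private theorem norm_abs_cpow' {x : ℝ} (hx : x ≠ 0) (r : ℂ) :
    ‖((|x| : ℝ) : ℂ) ^ r‖ = |x| ^ r.re :=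
  Complex.norm_cpow_eq_rpow_re_of_pos (abs_pos.mpr hx) r

/-! ### The test function `w⁻¹ξ` extended evenly: `invSqrtEvenExt ξ` is smooth, even, compactly supported -/

section TestFunction

variable {ξ : ℝ → ℂ}

/-- A function with compact support inside `(0, ∞)` vanishes on `(-∞, δ)` for some `δ > 0`. [folklore] -/
private theorem exists_pos_forall_lt_eq_zero (hsupp : HasCompactSupport ξ)
    (hpos : tsupport ξ ⊆ Ioi 0) : ∃ δ : ℝ, 0 < δ ∧ ∀ x, x < δ → ξ x = 0 := by
  by_cases hne : (tsupport ξ).Nonempty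
  · obtain ⟨m, hm, hmin⟩ := hsupp.isCompact.exists_isMinOn hne continuous_id.continuousOn
    refine ⟨m, hpos hm, fun x hx => image_eq_zero_of_notMem_tsupport fun hx' => ?_⟩
    have h : m ≤ x := by simpa using (isMinOn_iff.1 hmin) x hx'
    exact (not_le.mpr hx) h
  · exact ⟨1, one_pos, fun x _ => image_eq_zero_of_notMem_tsupport fun hx' => hne ⟨x, hx'⟩⟩

/-- A function with compact support vanishes on `(R, ∞)` for some `R`. [folklore] -/
private theorem exists_forall_gt_eq_zero (hsupp : HasCompactSupport ξ) :
    ∃ R : ℝ, ∀ x, R < x → ξ x = 0 := by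
  obtain ⟨R, hR⟩ := hsupp.isCompact.isBounded.subset_closedBall (0 : ℝ)
  refine ⟨R, fun x hx => image_eq_zero_of_notMem_tsupport fun hx' => ?_⟩
  have h := hR hx'
  rw [Metric.mem_closedBall, dist_zero_right, Real.norm_eq_abs] at h
  exact (not_le.mpr hx) ((le_abs_self x).trans h)

/-- Smoothness of the one-sided function `y ↦ (√y)⁻¹ ξ(y)` (it vanishes near `y ≤ 0`). [folklore] -/
private theorem contDiff_invSqrt_mul (hξ : ContDiff ℝ ∞ ξ) (hsupp : HasCompactSupport ξ)
    (hpos : tsupport ξ ⊆ Ioi 0) :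
    ContDiff ℝ ∞ fun y : ℝ => (((Real.sqrt y)⁻¹ : ℝ) : ℂ) * ξ y := by
  obtain ⟨δ, hδ, h0⟩ := exists_pos_forall_lt_eq_zero hsupp hpos
  refine contDiff_iff_contDiffAt.2 fun y => ?_
  rcases lt_or_ge y δ with hy | hy
  · have hev : (fun y : ℝ => (((Real.sqrt y)⁻¹ : ℝ) : ℂ) * ξ y) =ᶠ[𝓝 y] fun _ => 0 := by
      filter_upwards [Iio_mem_nhds hy] with t ht
      rw [h0 t ht, mul_zero]
    exact contDiffAt_const.congr_of_eventuallyEq hev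
  · have hy0 : 0 < y := hδ.trans_le hy
    have h1 : ContDiffAt ℝ ∞ (fun t : ℝ => (Real.sqrt t)⁻¹) y :=
      (Real.contDiffAt_sqrt hy0.ne').inv (Real.sqrt_ne_zero'.mpr hy0)
    have h2 : ContDiffAt ℝ ∞ (fun t : ℝ => (((Real.sqrt t)⁻¹ : ℝ) : ℂ)) y :=
      Complex.ofRealCLM.contDiff.contDiffAt.comp y h1
    exact h2.mul hξ.contDiffAt

/-- `invSqrtEvenExt ξ` is the one-sided function plus its reflection. [folklore] -/
private theorem invSqrtEvenExt_eq_add (hsupp : HasCompactSupport ξ) (hpos : tsupport ξ ⊆ Ioi 0) :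
    invSqrtEvenExt ξ = fun x =>
      (((Real.sqrt x)⁻¹ : ℝ) : ℂ) * ξ x + (((Real.sqrt (-x))⁻¹ : ℝ) : ℂ) * ξ (-x) := by
  obtain ⟨δ, hδ, h0⟩ := exists_pos_forall_lt_eq_zero hsupp hpos
  funext x
  simp only [invSqrtEvenExt]
  rcases le_or_gt 0 x with hx | hx
  · rw [abs_of_nonneg hx, h0 (-x) (by linarith), mul_zero, add_zero]
  · rw [abs_of_neg hx, h0 x (hx.trans hδ), mul_zero, zero_add]

/-- **`w⁻¹ξ` extended evenly is smooth** for `ξ ∈ C_c^∞(ℝ₊*)` (the function `|x|^{-1/2}ξ(|x|)` of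
display (FwIPhi), §1 p. 7, is in `C_c^∞(ℝ ∖ {0})`). [cite: ConnesConsani2021, §1 p. 7 (chunk p0007:L89–L92)] -/
theorem contDiff_invSqrtEvenExt (hξ : ContDiff ℝ ∞ ξ) (hsupp : HasCompactSupport ξ)
    (hpos : tsupport ξ ⊆ Ioi 0) : ContDiff ℝ ∞ (invSqrtEvenExt ξ) := by
  rw [invSqrtEvenExt_eq_add hsupp hpos]
  have hg := contDiff_invSqrt_mul hξ hsupp hpos
  exact hg.add (hg.comp contDiff_neg)

/-- `w⁻¹ξ` extended evenly is even. [cite: ConnesConsani2021, §1 p. 7 (chunk p0007:L89–L92)] -/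
theorem invSqrtEvenExt_neg (ξ : ℝ → ℂ) (x : ℝ) : invSqrtEvenExt ξ (-x) = invSqrtEvenExt ξ x := by
  simp [invSqrtEvenExt, abs_neg]

/-- `w⁻¹ξ` extended evenly has compact support when `ξ` has. [cite: ConnesConsani2021, §1 p. 7 (chunk p0007:L89–L92)] -/
theorem hasCompactSupport_invSqrtEvenExt (hsupp : HasCompactSupport ξ) :
    HasCompactSupport (invSqrtEvenExt ξ) := by
  obtain ⟨R, hR⟩ := exists_forall_gt_eq_zero hsupp
  refine HasCompactSupport.intro (isCompact_Icc : IsCompact (Icc (-R) R)) fun x hx => ?_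
  have hx' : R < |x| := by
    rw [mem_Icc, not_and_or, not_le, not_le] at hx
    rcases hx with h | h
    · have : R < -x := by linarith
      exact this.trans_le (neg_le_abs x)
    · exact h.trans_le (le_abs_self x)
  simp [invSqrtEvenExt, hR _ hx']

/-- `w⁻¹ξ` extended evenly is integrable. [cite: ConnesConsani2021, §1 p. 7 (chunk p0007:L89–L92)] -/
theorem integrable_invSqrtEvenExt (hξ : ContDiff ℝ ∞ ξ) (hsupp : HasCompactSupport ξ)
    (hpos : tsupport ξ ⊆ Ioi 0) : Integrable (invSqrtEvenExt ξ) :=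
  (contDiff_invSqrtEvenExt hξ hsupp hpos).continuous.integrable_of_hasCompactSupport
    (hasCompactSupport_invSqrtEvenExt hsupp)

/-- The Fourier transform of `w⁻¹ξ` extended evenly is integrable (it is a Schwartz function).
[cite: ConnesConsani2021, §1 p. 7 (chunk p0007:L89–L95)] -/
theorem integrable_fourier_invSqrtEvenExt (hξ : ContDiff ℝ ∞ ξ) (hsupp : HasCompactSupport ξ)
    (hpos : tsupport ξ ⊆ Ioi 0) : Integrable (𝓕 (invSqrtEvenExt ξ)) := by
  have h := (𝓕 ((hasCompactSupport_invSqrtEvenExt hsupp).toSchwartzMap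
    (contDiff_invSqrtEvenExt hξ hsupp hpos))).integrable (μ := volume)
  rw [SchwartzMap.fourier_coe] at h
  exact h

/-- `|x|^c · (w⁻¹ξ)(|x|)` is continuous (it vanishes near `0`). [folklore] -/
private theorem continuous_abs_cpow_mul_invSqrtEvenExt (hξ : ContDiff ℝ ∞ ξ)
    (hsupp : HasCompactSupport ξ) (hpos : tsupport ξ ⊆ Ioi 0) (c : ℂ) :
    Continuous fun x : ℝ => ((|x| : ℝ) : ℂ) ^ c * invSqrtEvenExt ξ x := by
  obtain ⟨δ, hδ, h0⟩ := exists_pos_forall_lt_eq_zero hsupp hpos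
  have hG : Continuous (invSqrtEvenExt ξ) := (contDiff_invSqrtEvenExt hξ hsupp hpos).continuous
  refine continuous_iff_continuousAt.2 fun x => ?_
  rcases lt_or_ge |x| δ with hx | hx
  · have hev : (fun x : ℝ => ((|x| : ℝ) : ℂ) ^ c * invSqrtEvenExt ξ x) =ᶠ[𝓝 x] fun _ => 0 := by
      have hball : Metric.ball x (δ - |x|) ∈ 𝓝 x := Metric.ball_mem_nhds x (by linarith)
      filter_upwards [hball] with t ht
      have ht' : |t| < δ := by
        rw [Metric.mem_ball, Real.dist_eq] at ht
        calc |t| = |(t - x) + x| := by ring_nf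
          _ ≤ |t - x| + |x| := abs_add_le _ _
          _ < δ := by linarith
      simp [invSqrtEvenExt, h0 _ ht']
    exact hev.continuousAt
  · have hx0 : x ≠ 0 := by
      intro h
      rw [h, abs_zero] at hx
      exact (not_le.mpr hδ) hx
    have h1 : ContinuousAt (fun x : ℝ => ((|x| : ℝ) : ℂ) ^ c) x :=
      ContinuousAt.comp (g := fun w : ℂ => w ^ c)
        (continuousAt_cpow_const (Complex.ofReal_mem_slitPlane.2 (abs_pos.2 hx0)))
        (Complex.continuous_ofReal.comp continuous_abs).continuousAt
    exact h1.mul hG.continuousAt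

/-- `|x|^c · (w⁻¹ξ)(|x|)` is integrable for every `c` (`ζ(w⁻¹ξ, |·|^{c+1})` converges absolutely). [folklore] -/
private theorem integrable_abs_cpow_mul_invSqrtEvenExt (hξ : ContDiff ℝ ∞ ξ)
    (hsupp : HasCompactSupport ξ) (hpos : tsupport ξ ⊆ Ioi 0) (c : ℂ) :
    Integrable fun x : ℝ => ((|x| : ℝ) : ℂ) ^ c * invSqrtEvenExt ξ x :=
  (continuous_abs_cpow_mul_invSqrtEvenExt hξ hsupp hpos c).integrable_of_hasCompactSupport
    (hasCompactSupport_invSqrtEvenExt hsupp).mul_left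

end TestFunction

/-- `ζ(h, |·|^{w+1}) = ∫ |y|^w h(y) dy` converges absolutely for `h` bounded and integrable and
`-1 < re w ≤ 0` (near `0` compare with `|y|^{re w}`, away from `0` with `|h|`). [folklore] -/
private theorem integrable_abs_cpow_mul_of_norm_le {h : ℝ → ℂ} {M : ℝ} (hi : Integrable h)
    (hb : ∀ y, ‖h y‖ ≤ M) {w : ℂ} (hw0 : -1 < w.re) (hw1 : w.re ≤ 0) :
    Integrable fun y : ℝ => ((|y| : ℝ) : ℂ) ^ w * h y := by
  have hmeas : AEStronglyMeasurable (fun y : ℝ => ((|y| : ℝ) : ℂ) ^ w * h y) :=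
    ((Complex.measurable_ofReal.comp continuous_abs.measurable).pow_const w).aestronglyMeasurable.mul
      hi.aestronglyMeasurable
  have hM : 0 ≤ M := (norm_nonneg _).trans (hb 0)
  rw [← integrableOn_univ, ← union_compl_self (Ioo (-1 : ℝ) 1), integrableOn_union]
  constructor
  · -- near `0`: dominated by `M |y|^{re w}`
    have hr : IntegrableOn (fun y : ℝ => |y| ^ w.re) (Ioo 0 1) := by
      refine ((intervalIntegral.integrableOn_Ioo_rpow_iff zero_lt_one).2 hw0).congr_fun
        (fun y hy => ?_) measurableSet_Ioo
      rw [abs_of_pos hy.1]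
    have hl : IntegrableOn (fun y : ℝ => |y| ^ w.re) (Ioo (-1) 0) := by
      have e1 : (Neg.neg ⁻¹' Ioo (0 : ℝ) 1) = Ioo (-1) 0 := by
        ext y; simp only [mem_preimage, mem_Ioo]; constructor <;> intro h <;> constructor <;> linarith
      have e2 : ((fun y : ℝ => |y| ^ w.re) ∘ Neg.neg) = fun y : ℝ => |y| ^ w.re := by
        funext y; simp [abs_neg]
      have := ((Measure.measurePreserving_neg (volume : Measure ℝ)).integrableOn_comp_preimage
        (Homeomorph.neg ℝ).measurableEmbedding).2 hr
      rwa [e1, e2] at this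
    have hm : IntegrableOn (fun y : ℝ => |y| ^ w.re) (Ioo (-1) 1) := by
      have hl' : IntegrableOn (fun y : ℝ => |y| ^ w.re) (Ioc (-1) 0) := by
        rw [integrableOn_Ioc_iff_integrableOn_Ioo]; exact hl
      have e : Ioo (-1 : ℝ) 1 = Ioc (-1) 0 ∪ Ioo 0 1 := by
        ext y; simp only [mem_union, mem_Ioo, mem_Ioc]
        constructor
        · intro h
          rcases le_or_gt y 0 with hy | hy
          · exact Or.inl ⟨h.1, hy⟩
          · exact Or.inr ⟨hy, h.2⟩
        · rintro (h | h) <;> constructor <;> linarith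
      rw [e]
      exact hl'.union hr
    refine Integrable.mono' (hm.const_mul M) hmeas.restrict ?_
    filter_upwards [ae_restrict_mem measurableSet_Ioo,
      ae_restrict_of_ae ae_ne_zero'] with y hy hy0
    rw [norm_mul, norm_abs_cpow' hy0, mul_comm]
    exact mul_le_mul_of_nonneg_right (hb y) (Real.rpow_nonneg (abs_nonneg y) _)
  · -- away from `0`: dominated by `‖h‖`
    refine Integrable.mono' hi.norm.integrableOn hmeas.restrict ?_
    filter_upwards [ae_restrict_mem (measurableSet_Ioo.compl)] with y hy
    have hy1 : 1 ≤ |y| := by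
      simp only [mem_compl_iff, mem_Ioo, not_and_or, not_lt] at hy
      rcases hy with h | h
      · calc (1 : ℝ) ≤ -y := by linarith
          _ ≤ |y| := neg_le_abs y
      · exact h.trans (le_abs_self y)
    have hy0 : y ≠ 0 := fun h => by rw [h, abs_zero] at hy1; exact absurd hy1 (by norm_num)
    rw [norm_mul, norm_abs_cpow' hy0]
    calc |y| ^ w.re * ‖h y‖ ≤ 1 * ‖h y‖ :=
          mul_le_mul_of_nonneg_right (Real.rpow_le_one_of_one_le_of_nonpos hy1 hw1) (norm_nonneg _)
      _ = ‖h y‖ := one_mul _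

/-- `√v = v^{1/2}` as a complex power, `v > 0`. [folklore] -/
private theorem ofReal_sqrt_eq_cpow {v : ℝ} (hv : 0 < v) : ((Real.sqrt v : ℝ) : ℂ) = (v : ℂ) ^ (1 / 2 : ℂ) := by
  rw [Real.sqrt_eq_rpow, Complex.ofReal_cpow hv.le]; push_cast; rfl

/-- Two functions that agree on `(0, ∞)` have the same Mellin transform. [folklore] -/
private theorem mellin_congr_Ioi {f g : ℝ → ℂ} (h : ∀ t ∈ Ioi (0 : ℝ), f t = g t) (s : ℂ) :
    mellin f s = mellin g s :=
  setIntegral_congr_fun measurableSet_Ioi fun t ht => by simp only [h t ht]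

/-- **`u_∞ = Γ_ℝ(½ + is)/Γ_ℝ(½ − is)`**: the unitary `u_∞(s) = e^{2iθ(s)}` of Lemma 6 is Tate's
`ρ(|·|^{1/2+is}) = π^{-is}Γ(¼ + is/2)/Γ(¼ − is/2)` (App. B eq. (84) «riesie» p. 31:
`θ(E) = −(E/2)log π + Im log Γ(¼ + iE/2)`), via the tree's `χ(½+it) e^{2iϑ(t)} = 1` and
`χ(½+it) = π^{it}Γ(¼ − it/2)/Γ(¼ + it/2)` (`RiemannZetaChiTheta`).
[cite: ConnesConsani2021, §1 eq. (14) p. 7 and App. B eq. (84) p. 31] -/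
theorem archUnitary_eq_Gammaℝ_div (s : ℝ) :
    archUnitary s = Complex.Gammaℝ (1 / 2 + s * I) / Complex.Gammaℝ (1 / 2 - s * I) := by
  have hχ := riemannZetaChi_half_mul_cexp_two_theta s
  have hne : riemannZetaChi (1 / 2 + s * I) ≠ 0 := by
    intro h; rw [h, zero_mul] at hχ; exact zero_ne_one hχ
  have h1 : cexp (2 * (riemannSiegelTheta s : ℂ) * I) = (riemannZetaChi (1 / 2 + s * I))⁻¹ :=
    eq_inv_of_mul_eq_one_right hχ
  have hπ : (π : ℂ) ≠ 0 := by exact_mod_cast Real.pi_ne_zero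
  have hΓa : Complex.Gamma (1 / 4 - s / 2 * I) ≠ 0 := Complex.Gamma_ne_zero_of_re_pos (by simp)
  have hΓb : Complex.Gamma (1 / 4 + s / 2 * I) ≠ 0 := Complex.Gamma_ne_zero_of_re_pos (by simp)
  have hπs : (π : ℂ) ^ ((s : ℂ) * I) ≠ 0 := by
    rw [Ne, Complex.cpow_eq_zero_iff]; exact fun h => hπ h.1
  unfold archUnitary
  rw [h1, riemannZetaChi_half_eq_Gamma_div, Complex.Gammaℝ_def, Complex.Gammaℝ_def,
    show (1 / 2 + (s : ℂ) * I) / 2 = 1 / 4 + s / 2 * I by ring,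
    show (1 / 2 - (s : ℂ) * I) / 2 = 1 / 4 - s / 2 * I by ring,
    show -(1 / 2 + (s : ℂ) * I) / 2 = -((s : ℂ) * I) + (-(1 / 2 - (s : ℂ) * I) / 2) by ring,
    Complex.cpow_add _ _ hπ, Complex.cpow_neg]
  have hπt : (π : ℂ) ^ (-(1 / 2 - (s : ℂ) * I) / 2) ≠ 0 := by
    rw [Ne, Complex.cpow_eq_zero_iff]; exact fun h => hπ h.1
  field_simp

/-- **Lemma 6 DISCHARGED** (§1 p. 7; App. B p. 31: "`u_∞` from Tate's local functional equation"):
`𝔽_μ(I ∘ w ∘ 𝔽_{e_ℝ} ∘ w⁻¹ ξ)(s) = u_∞(s) 𝔽_μ(ξ)(s)` on `C_c^∞(ℝ₊*)`.  Proof as printed in App. B: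
with `G = w⁻¹ξ` extended evenly (`invSqrtEvenExt ξ ∈ C_c^∞(ℝ∖{0})`, even), the display (FwIPhi)
(`archOp_eq_sqrtWeight_fourier_inv`, PROVED in `SchwartzKernels`) and the substitutions `λ = v⁻¹`,
`v^{1/2}` (`mellin_comp_inv`, `mellin_cpow_smul`) give
`𝔽_μ(archOp ξ)(−is) = (mellin 𝓕G)(½ + is)` and `𝔽_μ(ξ)(−is) = (mellin G)(½ − is)`; Tate's local
functional equation at the real place (`TateArchimedean.mellin_fourier_mul_Gammaℝ_of_even`, Tate 1950
Thm. 2.4.1 with `ρ(|·|^z) = Γ_ℝ(z)/Γ_ℝ(1−z)`) gives `(mellin 𝓕G)(z) = ρ(|·|^z)(mellin G)(1−z)` at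
`z = ½ + is`, and `ρ(|·|^{½+is}) = π^{-is}Γ(¼+is/2)/Γ(¼−is/2) = e^{2iθ(s)} = u_∞(s)`
(`archUnitary_eq_Gammaℝ_div`).
[cite: ConnesConsani2021, §1 Lemma 6 (arXiv numbering) p. 7 (chunk p0007:L76–L86); App. B p. 31; TateThesis1967, §2.4 Thm. 2.4.1, §2.5] -/
theorem CC2021_lemma_6_holds : CC2021_lemma_6 := by
  intro ξ hξ hsupp hpos s
  set G : ℝ → ℂ := invSqrtEvenExt ξ with hGdef
  set z : ℂ := 1 / 2 + s * I with hz
  have hGi : Integrable G := integrable_invSqrtEvenExt hξ hsupp hpos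
  -- the left-hand side is `(mellin 𝓕G)(z)`
  have hL : mellin (archOp ξ) (-(s * I)) = mellin (𝓕 G) z := by
    have h1 : archOp ξ = fun l => (sqrtWeight (𝓕 G)) l⁻¹ :=
      funext fun l => archOp_eq_sqrtWeight_fourier_inv hGi l
    rw [h1, mellin_comp_inv, neg_neg]
    have h2 : mellin (sqrtWeight (𝓕 G)) (s * I) =
        mellin (fun v : ℝ => (v : ℂ) ^ (1 / 2 : ℂ) • 𝓕 G v) (s * I) :=
      mellin_congr_Ioi (fun v hv => by
        simp only [sqrtWeight, smul_eq_mul]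
        rw [ofReal_sqrt_eq_cpow hv]) _
    rw [h2, mellin_cpow_smul, hz, add_comm]
  -- the right-hand side is `(mellin G)(1 - z)`
  have hR : mellin ξ (-(s * I)) = mellin G (1 - z) := by
    have h2 : mellin ξ (-(s * I)) =
        mellin (fun v : ℝ => (v : ℂ) ^ (1 / 2 : ℂ) • G v) (-(s * I)) :=
      mellin_congr_Ioi (fun v hv => by
        have hmem : v ∈ Ioi (0 : ℝ) := hv
        have hv' : (0 : ℝ) < v := hmem
        simp only [hGdef, invSqrtEvenExt, smul_eq_mul, abs_of_pos hv']
        rw [← ofReal_sqrt_eq_cpow hv', Complex.ofReal_inv]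
        have hne : ((Real.sqrt v : ℝ) : ℂ) ≠ 0 := by exact_mod_cast (Real.sqrt_pos.2 hv').ne'
        field_simp) _
    rw [h2, mellin_cpow_smul, hz]
    congr 1; ring
  -- Tate's local functional equation at `z = ½ + is`
  have hz0 : 0 < z.re := by simp [hz]
  have hz1 : z.re < 1 := by simp [hz]; norm_num
  have hfz : Integrable fun x : ℝ => ((|x| : ℝ) : ℂ) ^ (-z) * G x :=
    integrable_abs_cpow_mul_invSqrtEvenExt hξ hsupp hpos (-z)
  have hFf : Integrable fun y : ℝ => ((|y| : ℝ) : ℂ) ^ (z - 1) * 𝓕 G y := by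
    refine integrable_abs_cpow_mul_of_norm_le (M := ∫ v, ‖G v‖)
      (integrable_fourier_invSqrtEvenExt hξ hsupp hpos) (fun y => ?_) (by norm_num [hz])
      (by norm_num [hz])
    exact VectorFourier.norm_fourierIntegral_le_integral_norm _ _ _ _ _
  have hT := mellin_fourier_mul_Gammaℝ_of_even hz0 hz1 (invSqrtEvenExt_neg ξ) hGi hfz hFf
  have hΓne : Complex.Gammaℝ (1 - z) ≠ 0 :=
    Complex.Gammaℝ_ne_zero_of_re_pos (by rw [Complex.sub_re, Complex.one_re]; linarith)
  have hu : archUnitary s = Complex.Gammaℝ z / Complex.Gammaℝ (1 - z) := by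
    rw [archUnitary_eq_Gammaℝ_div, hz]
    congr 2; ring
  rw [hL, hR, hu, div_mul_eq_mul_div, eq_div_iff hΓne, hT]

end Literature.NumberTheory.ConnesConsani2021
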